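import Literature.Topology.FourManifolds.NullImages
import Mathlib.Analysis.SpecialFunctions.SmoothTransition
import Mathlib.Analysis.SpecialFunctions.Trigonometric.Deriv
import Mathlib.Analysis.InnerProductSpace.PiL2
import Mathlib.Analysis.Calculus.ContDiff.Deriv
import Mathlib.MeasureTheory.Measure.Haar.InnerProductSpace
import HarnessLib

/-!
# Long annuli in `ℝ³ × ℝ` and the generic double shear of a spanning arc

Topic `Literature/Topology/FourManifolds`; infrastructure for the proof programme of the
Fox–Milnor fact `Literature.Topology.FourManifolds.Knot.exists_isConnectedSum_isConcordant`
(straightening a spanning arc of the second concordance, read in a chart of the shell as a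
surface in `ℝ³ × [1, 2]`). Everything here is proved; no named fact is introduced.

* `LongAnnulus η` — the chart picture of a conical concordance: a `C^∞` map
  `F : ℝ × ℝ → ℝ³ × ℝ`, `(θ, s) ↦ (position, level)`, `1`-periodic in `θ`, equal to the product
  `(k₁ θ, s)` for `s ≤ 1 + η` and to `(k₂ θ, s)` for `s ≥ 2 - η` (collars), with the **level
  margin at every scale `η' ≤ η`** (parameters `s ∈ [1 + η', 2 - η']` have levels in
  `[1 + η', 2 - η']`, and the open version), injective modulo the period on `ℝ × [1, 2]` and
  immersive there.
* The **double shear** `shear η v (x, t) = (x + β₁ t • v₁ + β₂ t • v₂, t)` by the plane curve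
  `β = (β₁, β₂) = bmp · (cos ang, sin ang)`, which vanishes for `t ≤ 1 + η/4` and `t ≥ 2 - η/4`,
  is injective on the open middle (`beta_inj`) and has nonvanishing velocity there
  (`not_deriv_beta_eq_zero`); `LongAnnulus.shearWith A v : LongAnnulus (η/4)` is the sheared
  annulus (same collars of width `η/4`, same levels).
* `LongAnnulus.exists_generic_shear` — **for generic `v = (v₁, v₂)` the spatial projection of
  the sheared spanning arc `τ ↦ (shear (F (θ₁, τ))).1` identifies only parameters at equal levels
  and is immersive, over the open middle**: the exceptional `v` satisfy affine conditions
  `a • v₁ + b • v₂ = Δ` with `(a, b) ≠ 0` parametrised by pairs of parameters resp. by one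
  parameter, a null set by `addHaar_setOf_exists_smul_add_smul_eq` (`NullImages.lean`); when the
  coefficients vanish, injectivity of `β` on the middle, resp. the immersivity of `F`, conclude.

## References

* H. Whitney, *Differentiable manifolds*, Ann. of Math. 37 (1936), §§5–8 (general position by
  generic linear perturbations). [Whitney1936]
* M. W. Hirsch, *Differential Topology*, GTM 33 (1976), Ch. 3 §2. [HirschDT1976]

## Design notes

`LongAnnulus` is a `Type`-valued structure carrying the map and its end curves; the shear
functions `bmp`, `ang`, `β₁`, `β₂`, `shear` are plain definitions depending on the width `η`.
No named facts, no `sorry`; `𝔼 n` is local notation as in `Knots.lean`.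
-/

open scoped Topology ContDiff
open Function Set Metric Filter MeasureTheory

noncomputable section

namespace Literature.Topology.FourManifolds

/-- Local notation: `𝔼 n` is the model Euclidean space `EuclideanSpace ℝ (Fin n)`. -/
local notation "𝔼 " n:arg => EuclideanSpace ℝ (Fin n)

/-! ### Long annuli -/

/-- A **long annulus of width `η`**: the chart picture `F : (θ, s) ↦ (position, level)` of a
conical concordance in `ℝ³ × ℝ`, `C^∞`, `1`-periodic in `θ`, a product `(k₁ θ, s)` for
`s ≤ 1 + η` and `(k₂ θ, s)` for `s ≥ 2 - η`, with the level margin at every scale `η' ≤ η`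
(parameters in `[1 + η', 2 - η']`, resp. `(1 + η', 2 - η')`, have levels there), injective modulo
the period on `ℝ × [1, 2]` and with injective differential there. [folklore] -/
structure LongAnnulus (η : ℝ) where
  /-- The annulus `(θ, s) ↦ (position, level)`. -/
  F : ℝ × ℝ → 𝔼 3 × ℝ
  /-- The lower end curve. -/
  k₁ : ℝ → 𝔼 3
  /-- The upper end curve. -/
  k₂ : ℝ → 𝔼 3
  contDiff_F : ContDiff ℝ ∞ F
  η_pos : 0 < η
  η_le : η ≤ 1 / 4
  F_add_one : ∀ θ s, F (θ + 1, s) = F (θ, s)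
  collar₁ : ∀ θ s, s ≤ 1 + η → F (θ, s) = (k₁ θ, s)
  collar₂ : ∀ θ s, 2 - η ≤ s → F (θ, s) = (k₂ θ, s)
  margin : ∀ η' ∈ Icc 0 η, ∀ θ, ∀ s ∈ Icc (1 + η') (2 - η'), (F (θ, s)).2 ∈ Icc (1 + η') (2 - η')
  margin_Ioo : ∀ η' ∈ Icc 0 η, ∀ θ, ∀ s ∈ Ioo (1 + η') (2 - η'),
    (F (θ, s)).2 ∈ Ioo (1 + η') (2 - η')
  inj : ∀ p q : ℝ × ℝ, p.2 ∈ Icc (1 : ℝ) 2 → q.2 ∈ Icc (1 : ℝ) 2 → F p = F q →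
    p.2 = q.2 ∧ ∃ m : ℤ, q.1 = p.1 + m
  injective_fderiv : ∀ p : ℝ × ℝ, p.2 ∈ Icc (1 : ℝ) 2 → Injective (fderiv ℝ F p)

namespace LongAnnulus

variable {η : ℝ} (A : LongAnnulus η)

/-- Integer translates in `θ`. [folklore] -/
theorem F_add_int (θ s : ℝ) (m : ℤ) : A.F (θ + m, s) = A.F (θ, s) := by
  have hp : Periodic (fun θ ↦ A.F (θ, s)) 1 := fun θ ↦ A.F_add_one θ s
  have := (hp.int_mul m) θ
  simpa using this

/-- The lower end curve is the position over `s = 1`. [folklore] -/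
theorem k₁_eq (θ : ℝ) : A.k₁ θ = (A.F (θ, 1)).1 := by
  rw [A.collar₁ θ 1 (by linarith [A.η_pos])]

/-- The upper end curve is the position over `s = 2`. [folklore] -/
theorem k₂_eq (θ : ℝ) : A.k₂ θ = (A.F (θ, 2)).1 := by
  rw [A.collar₂ θ 2 (by linarith [A.η_pos])]

/-- The lower end curve is `C^∞`. [folklore] -/
theorem contDiff_k₁ : ContDiff ℝ ∞ A.k₁ := by
  have : A.k₁ = fun θ ↦ (A.F (θ, 1)).1 := funext A.k₁_eq
  rw [this]
  exact contDiff_fst.comp (A.contDiff_F.comp (contDiff_id.prodMk contDiff_const))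

/-- The upper end curve is `C^∞`. [folklore] -/
theorem contDiff_k₂ : ContDiff ℝ ∞ A.k₂ := by
  have : A.k₂ = fun θ ↦ (A.F (θ, 2)).1 := funext A.k₂_eq
  rw [this]
  exact contDiff_fst.comp (A.contDiff_F.comp (contDiff_id.prodMk contDiff_const))

/-- The lower end curve is `1`-periodic. [folklore] -/
theorem k₁_add_one (θ : ℝ) : A.k₁ (θ + 1) = A.k₁ θ := by
  rw [A.k₁_eq, A.k₁_eq, A.F_add_one]

/-- The upper end curve is `1`-periodic. [folklore] -/
theorem k₂_add_one (θ : ℝ) : A.k₂ (θ + 1) = A.k₂ θ := by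
  rw [A.k₂_eq, A.k₂_eq, A.F_add_one]

/-- In the lower collar the level is the parameter. [folklore] -/
theorem snd_F_of_le {s : ℝ} (hs : s ≤ 1 + η) (θ : ℝ) : (A.F (θ, s)).2 = s := by
  rw [A.collar₁ θ s hs]

/-- In the upper collar the level is the parameter. [folklore] -/
theorem snd_F_of_ge {s : ℝ} (hs : 2 - η ≤ s) (θ : ℝ) : (A.F (θ, s)).2 = s := by
  rw [A.collar₂ θ s hs]

/-- Levels of parameters in `[1, 2]` are in `[1, 2]`. [folklore] -/
theorem snd_F_mem_Icc (θ : ℝ) {s : ℝ} (hs : s ∈ Icc (1 : ℝ) 2) : (A.F (θ, s)).2 ∈ Icc (1 : ℝ) 2 := by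
  have := A.margin 0 ⟨le_rfl, A.η_pos.le⟩ θ s (by simpa using hs)
  simpa using this

/-- Levels of parameters in `(1, 2)` are in `(1, 2)`. [folklore] -/
theorem snd_F_mem_Ioo (θ : ℝ) {s : ℝ} (hs : s ∈ Ioo (1 : ℝ) 2) : (A.F (θ, s)).2 ∈ Ioo (1 : ℝ) 2 := by
  have := A.margin_Ioo 0 ⟨le_rfl, A.η_pos.le⟩ θ s (by simpa using hs)
  simpa using this

/-- **A level in the lower zone `≤ 1 + η'` (any `0 ≤ η' ≤ η`) comes from the lower collar**: if
the level of `s` is `≤ 1 + η'` then `s ≤ 1 + η'` (open margin at scale `η'`; the upper collar is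
excluded since `η ≤ 1/4`), hence the level is `s`. [folklore] -/
theorem le_of_snd_F_le {η' : ℝ} (hη' : η' ∈ Icc 0 η) {θ s : ℝ}
    (h : (A.F (θ, s)).2 ≤ 1 + η') : s ≤ 1 + η' := by
  by_contra hlt
  push Not at hlt
  by_cases hs2 : s < 2 - η'
  · have hmem : s ∈ Ioo (1 + η') (2 - η') := ⟨hlt, hs2⟩
    have := (A.margin_Ioo η' hη' θ s hmem).1
    linarith
  · push Not at hs2
    have hge : 2 - η ≤ s := by linarith [hη'.2]
    rw [A.snd_F_of_ge hge] at h
    linarith [hη'.1, hη'.2, A.η_le]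

/-- Symmetrically for the upper zone. [folklore] -/
theorem ge_of_le_snd_F {η' : ℝ} (hη' : η' ∈ Icc 0 η) {θ s : ℝ}
    (h : 2 - η' ≤ (A.F (θ, s)).2) : 2 - η' ≤ s := by
  by_contra hlt
  push Not at hlt
  by_cases hs1 : 1 + η' < s
  · have hmem : s ∈ Ioo (1 + η') (2 - η') := ⟨hs1, hlt⟩
    have := (A.margin_Ioo η' hη' θ s hmem).2
    linarith
  · push Not at hs1
    have hle : s ≤ 1 + η := by linarith [hη'.2]
    rw [A.snd_F_of_le hle] at h
    linarith [hη'.1, hη'.2, A.η_le]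

/-- **Positions are bounded over `[1, 2]`** (periodicity and compactness). [folklore] -/
theorem exists_norm_fst_F_le : ∃ R : ℝ, ∀ θ, ∀ s ∈ Icc (1 : ℝ) 2, ‖(A.F (θ, s)).1‖ ≤ R := by
  have hc : Continuous fun p : ℝ × ℝ ↦ (A.F p).1 := continuous_fst.comp A.contDiff_F.continuous
  obtain ⟨R, hR⟩ := (isCompact_Icc.prod isCompact_Icc : IsCompact (Icc (0 : ℝ) 1 ×ˢ Icc (1 : ℝ) 2))
    |>.exists_bound_of_continuousOn hc.continuousOn
  refine ⟨R, fun θ s hs ↦ ?_⟩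
  have key : A.F (θ, s) = A.F (Int.fract θ, s) := by
    conv_lhs => rw [← Int.fract_add_floor θ]
    exact A.F_add_int _ s _
  rw [key]
  exact hR (Int.fract θ, s) ⟨⟨Int.fract_nonneg θ, (Int.fract_lt_one θ).le⟩, hs⟩

end LongAnnulus

/-! ### The plane curve of the double shear -/

namespace ArcShear

/-- The bump `bmp η t`: positive exactly for `1 + η/4 < t < 2 - η/4`, zero elsewhere. [folklore] -/
def bmp (η t : ℝ) : ℝ :=
  Real.smoothTransition (t - (1 + η / 4)) * Real.smoothTransition ((2 - η / 4) - t)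

/-- The angle `ang η t = π (t - 1 - η/4) / (1 - η/2)`: increases from `0` to `π` across the middle.
[folklore] -/
def ang (η t : ℝ) : ℝ := Real.pi * (t - (1 + η / 4)) / (1 - η / 2)

/-- First shear coefficient `β₁ = bmp · cos ang`. [folklore] -/
def β₁ (η t : ℝ) : ℝ := bmp η t * Real.cos (ang η t)

/-- Second shear coefficient `β₂ = bmp · sin ang`. [folklore] -/
def β₂ (η t : ℝ) : ℝ := bmp η t * Real.sin (ang η t)

variable {η : ℝ}

/-- The bump is `C^∞`. [folklore] -/
theorem contDiff_bmp (η : ℝ) : ContDiff ℝ ∞ (bmp η) :=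
  (Real.smoothTransition.contDiff.comp (contDiff_id.sub contDiff_const)).mul
    (Real.smoothTransition.contDiff.comp (contDiff_const.sub contDiff_id))

/-- The angle is `C^∞`. [folklore] -/
theorem contDiff_ang (η : ℝ) : ContDiff ℝ ∞ (ang η) :=
  (contDiff_const.mul (contDiff_id.sub contDiff_const)).div_const _

/-- `β₁` is `C^∞`. [folklore] -/
theorem contDiff_β₁ (η : ℝ) : ContDiff ℝ ∞ (β₁ η) :=
  (contDiff_bmp η).mul (Real.contDiff_cos.comp (contDiff_ang η))

/-- `β₂` is `C^∞`. [folklore] -/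
theorem contDiff_β₂ (η : ℝ) : ContDiff ℝ ∞ (β₂ η) :=
  (contDiff_bmp η).mul (Real.contDiff_sin.comp (contDiff_ang η))

/-- The bump is nonnegative. [folklore] -/
theorem bmp_nonneg (η t : ℝ) : 0 ≤ bmp η t :=
  mul_nonneg (Real.smoothTransition.nonneg _) (Real.smoothTransition.nonneg _)

/-- The bump vanishes for `t ≤ 1 + η/4`. [folklore] -/
theorem bmp_of_le {t : ℝ} (ht : t ≤ 1 + η / 4) : bmp η t = 0 := by
  rw [bmp, Real.smoothTransition.zero_of_nonpos (by linarith), zero_mul]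

/-- The bump vanishes for `t ≥ 2 - η/4`. [folklore] -/
theorem bmp_of_ge {t : ℝ} (ht : 2 - η / 4 ≤ t) : bmp η t = 0 := by
  rw [bmp, Real.smoothTransition.zero_of_nonpos (x := (2 - η / 4) - t) (by linarith), mul_zero]

/-- The bump is positive on the open middle. [folklore] -/
theorem bmp_pos {t : ℝ} (ht : t ∈ Ioo (1 + η / 4) (2 - η / 4)) : 0 < bmp η t :=
  mul_pos (Real.smoothTransition.pos_of_pos (by linarith [ht.1]))
    (Real.smoothTransition.pos_of_pos (by linarith [ht.2]))

/-- Off the open middle the bump vanishes. [folklore] -/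
theorem bmp_eq_zero_of_not_mem {t : ℝ} (ht : t ∉ Ioo (1 + η / 4) (2 - η / 4)) : bmp η t = 0 := by
  rcases not_and_or.1 ht with h | h
  · exact bmp_of_le (not_lt.1 h)
  · exact bmp_of_ge (not_lt.1 h)

/-- The shear coefficients vanish for `t ≤ 1 + η/4`. [folklore] -/
theorem β_of_le {t : ℝ} (ht : t ≤ 1 + η / 4) : β₁ η t = 0 ∧ β₂ η t = 0 := by
  simp [β₁, β₂, bmp_of_le ht]

/-- The shear coefficients vanish for `t ≥ 2 - η/4`. [folklore] -/
theorem β_of_ge {t : ℝ} (ht : 2 - η / 4 ≤ t) : β₁ η t = 0 ∧ β₂ η t = 0 := by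
  simp [β₁, β₂, bmp_of_ge ht]

/-- Off the open middle the shear coefficients vanish. [folklore] -/
theorem β_of_not_mem {t : ℝ} (ht : t ∉ Ioo (1 + η / 4) (2 - η / 4)) : β₁ η t = 0 ∧ β₂ η t = 0 := by
  simp [β₁, β₂, bmp_eq_zero_of_not_mem ht]

/-- On the open middle the angle lies in `(0, π)` (for `η ≤ 1/4`, indeed `η < 2`). [folklore] -/
theorem ang_mem_Ioo (hη : η ≤ 1 / 4) {t : ℝ} (ht : t ∈ Ioo (1 + η / 4) (2 - η / 4)) :
    ang η t ∈ Ioo 0 Real.pi := by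
  have hden : 0 < 1 - η / 2 := by linarith
  have hpi := Real.pi_pos
  constructor
  · rw [ang]
    exact div_pos (mul_pos hpi (by linarith [ht.1])) hden
  · rw [ang, div_lt_iff₀ hden]
    have : t - (1 + η / 4) < 1 - η / 2 := by linarith [ht.2]
    nlinarith

/-- On the open middle `β₂ > 0`. [folklore] -/
theorem β₂_pos (hη : η ≤ 1 / 4) {t : ℝ} (ht : t ∈ Ioo (1 + η / 4) (2 - η / 4)) : 0 < β₂ η t :=
  mul_pos (bmp_pos ht) (Real.sin_pos_of_mem_Ioo (ang_mem_Ioo hη ht))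

/-- The angle is injective. [folklore] -/
theorem ang_injective (hη : η ≤ 1 / 4) : Injective (ang η) := by
  intro t t' h
  have hden : (1 - η / 2) ≠ 0 := by linarith
  rw [ang, ang, div_left_inj' hden] at h
  have := mul_left_cancel₀ Real.pi_ne_zero h
  linarith

/-- **The shear curve is injective on the open middle**: if `β t = β t'` with `t` in the open
middle then `t = t'`. [folklore] -/
theorem beta_inj (hη : η ≤ 1 / 4) {t t' : ℝ} (h₁ : β₁ η t = β₁ η t') (h₂ : β₂ η t = β₂ η t')
    (ht : t ∈ Ioo (1 + η / 4) (2 - η / 4)) : t = t' := by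
  have ht' : t' ∈ Ioo (1 + η / 4) (2 - η / 4) := by
    by_contra hnot
    have := (β_of_not_mem hnot).2
    linarith [β₂_pos hη ht]
  have ha := ang_mem_Ioo hη ht
  have ha' := ang_mem_Ioo hη ht'
  have hb := bmp_pos ht
  have hb' := bmp_pos ht'
  -- `sin (ang t' - ang t) = 0`
  have hsin : Real.sin (ang η t' - ang η t) = 0 := by
    rw [Real.sin_sub]
    have e : bmp η t * bmp η t' * (Real.sin (ang η t') * Real.cos (ang η t) -
        Real.cos (ang η t') * Real.sin (ang η t)) = 0 := by
      have := congrArg₂ (· * ·) h₁ h₂.symm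
      simp only [β₁, β₂] at this
      linear_combination this
    rcases mul_eq_zero.1 e with e' | e'
    · rcases mul_eq_zero.1 e' with e'' | e'' <;> linarith
    · exact e'
  have hang : ang η t' - ang η t = 0 :=
    (Real.sin_eq_zero_iff_of_lt_of_lt (by linarith [ha.1, ha'.2, ha.2, ha'.1])
      (by linarith [ha.1, ha'.2, ha.2, ha'.1])).1 hsin
  exact ang_injective hη (by linarith)

/-- The derivative of the angle. [folklore] -/
theorem hasDerivAt_ang (η t : ℝ) : HasDerivAt (ang η) (Real.pi / (1 - η / 2)) t := by
  have h : HasDerivAt (fun t ↦ Real.pi * (t - (1 + η / 4)) / (1 - η / 2))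
      (Real.pi * 1 / (1 - η / 2)) t :=
    (((hasDerivAt_id t).sub_const _).const_mul Real.pi).div_const _
  have e : ang η = fun t ↦ Real.pi * (t - (1 + η / 4)) / (1 - η / 2) := rfl
  rw [e, show Real.pi / (1 - η / 2) = Real.pi * 1 / (1 - η / 2) by rw [mul_one]]
  exact h

/-- The derivative of `β₁`. [folklore] -/
theorem hasDerivAt_β₁ (η t : ℝ) :
    HasDerivAt (β₁ η) (deriv (bmp η) t * Real.cos (ang η t) -
      bmp η t * (Real.sin (ang η t) * (Real.pi / (1 - η / 2)))) t := by
  have hb : HasDerivAt (fun t ↦ bmp η t) (deriv (bmp η) t) t :=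
    (((contDiff_bmp η).differentiable (by simp)) t).hasDerivAt
  have hc : HasDerivAt (fun t ↦ Real.cos (ang η t)) (-Real.sin (ang η t) * (Real.pi / (1 - η / 2))) t :=
    (hasDerivAt_ang η t).cos
  have h : HasDerivAt (fun t ↦ bmp η t * Real.cos (ang η t))
      (deriv (bmp η) t * Real.cos (ang η t) +
        bmp η t * (-Real.sin (ang η t) * (Real.pi / (1 - η / 2)))) t := hb.mul hc
  have e : β₁ η = fun t ↦ bmp η t * Real.cos (ang η t) := rfl
  rw [e]
  refine h.congr_deriv ?_
  ring

/-- The derivative of `β₂`. [folklore] -/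
theorem hasDerivAt_β₂ (η t : ℝ) :
    HasDerivAt (β₂ η) (deriv (bmp η) t * Real.sin (ang η t) +
      bmp η t * (Real.cos (ang η t) * (Real.pi / (1 - η / 2)))) t := by
  have hb : HasDerivAt (fun t ↦ bmp η t) (deriv (bmp η) t) t :=
    (((contDiff_bmp η).differentiable (by simp)) t).hasDerivAt
  have hs : HasDerivAt (fun t ↦ Real.sin (ang η t)) (Real.cos (ang η t) * (Real.pi / (1 - η / 2))) t :=
    (hasDerivAt_ang η t).sin
  have h : HasDerivAt (fun t ↦ bmp η t * Real.sin (ang η t))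
      (deriv (bmp η) t * Real.sin (ang η t) +
        bmp η t * (Real.cos (ang η t) * (Real.pi / (1 - η / 2)))) t := hb.mul hs
  have e : β₂ η = fun t ↦ bmp η t * Real.sin (ang η t) := rfl
  rw [e]
  exact h

/-- **The velocity of the shear curve does not vanish on the open middle**:
`-sin(ang) β₁' + cos(ang) β₂' = bmp · ang' > 0`. [folklore] -/
theorem not_deriv_beta_eq_zero (hη : η ≤ 1 / 4) {t : ℝ} (ht : t ∈ Ioo (1 + η / 4) (2 - η / 4)) :
    ¬ (deriv (β₁ η) t = 0 ∧ deriv (β₂ η) t = 0) := by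
  rintro ⟨h1, h2⟩
  rw [(hasDerivAt_β₁ η t).deriv] at h1
  rw [(hasDerivAt_β₂ η t).deriv] at h2
  have key : -Real.sin (ang η t) * (deriv (bmp η) t * Real.cos (ang η t) -
      bmp η t * (Real.sin (ang η t) * (Real.pi / (1 - η / 2)))) +
      Real.cos (ang η t) * (deriv (bmp η) t * Real.sin (ang η t) +
      bmp η t * (Real.cos (ang η t) * (Real.pi / (1 - η / 2)))) =
      bmp η t * (Real.pi / (1 - η / 2)) := by
    have := Real.sin_sq_add_cos_sq (ang η t)
    linear_combination bmp η t * (Real.pi / (1 - η / 2)) * this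
  rw [h1, h2, mul_zero, mul_zero, zero_add] at key
  have hpos : 0 < bmp η t * (Real.pi / (1 - η / 2)) :=
    mul_pos (bmp_pos ht) (div_pos Real.pi_pos (by linarith))
  linarith

/-! ### The double shear -/

/-- **The double shear** by `v = (v₁, v₂)`: `(x, t) ↦ (x + β₁ t • v₁ + β₂ t • v₂, t)`; a
level-preserving diffeomorphism, the identity at levels `t ≤ 1 + η/4` and `t ≥ 2 - η/4`.
[folklore] -/
def shear (η : ℝ) (v : 𝔼 3 × 𝔼 3) (p : 𝔼 3 × ℝ) : 𝔼 3 × ℝ :=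
  (p.1 + β₁ η p.2 • v.1 + β₂ η p.2 • v.2, p.2)

/-- The level is preserved. [folklore] -/
@[simp] theorem shear_snd (η : ℝ) (v : 𝔼 3 × 𝔼 3) (p : 𝔼 3 × ℝ) : (shear η v p).2 = p.2 := rfl

/-- The position after the shear. [folklore] -/
@[simp] theorem shear_fst (η : ℝ) (v : 𝔼 3 × 𝔼 3) (p : 𝔼 3 × ℝ) :
    (shear η v p).1 = p.1 + β₁ η p.2 • v.1 + β₂ η p.2 • v.2 := rfl

/-- The shear is `C^∞`. [folklore] -/
theorem contDiff_shear (η : ℝ) (v : 𝔼 3 × 𝔼 3) : ContDiff ℝ ∞ (shear η v) :=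
  ((contDiff_fst.add (((contDiff_β₁ η).comp contDiff_snd).smul contDiff_const)).add
    (((contDiff_β₂ η).comp contDiff_snd).smul contDiff_const)).prodMk contDiff_snd

/-- The shear by `-v` undoes the shear by `v`. [folklore] -/
theorem shear_neg_shear (η : ℝ) (v : 𝔼 3 × 𝔼 3) (p : 𝔼 3 × ℝ) : shear η (-v) (shear η v p) = p := by
  obtain ⟨x, t⟩ := p
  simp only [shear, Prod.fst_neg, Prod.snd_neg, smul_neg, Prod.mk.injEq, and_true]
  abel

/-- The shear is injective. [folklore] -/
theorem shear_injective (η : ℝ) (v : 𝔼 3 × 𝔼 3) : Injective (shear η v) :=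
  LeftInverse.injective (shear_neg_shear η v)

/-- The shear is the identity at levels `≤ 1 + η/4`. [folklore] -/
theorem shear_of_le (v : 𝔼 3 × 𝔼 3) {p : 𝔼 3 × ℝ} (hp : p.2 ≤ 1 + η / 4) : shear η v p = p := by
  obtain ⟨h1, h2⟩ := β_of_le hp
  obtain ⟨x, t⟩ := p
  simp [shear, h1, h2]

/-- The shear is the identity at levels `≥ 2 - η/4`. [folklore] -/
theorem shear_of_ge (v : 𝔼 3 × 𝔼 3) {p : 𝔼 3 × ℝ} (hp : 2 - η / 4 ≤ p.2) : shear η v p = p := by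
  obtain ⟨h1, h2⟩ := β_of_ge hp
  obtain ⟨x, t⟩ := p
  simp [shear, h1, h2]

/-- The derivative of the shear is injective (it has the derivative of the inverse shear as a
left inverse). [folklore] -/
theorem injective_fderiv_shear (η : ℝ) (v : 𝔼 3 × 𝔼 3) (p : 𝔼 3 × ℝ) :
    Injective (fderiv ℝ (shear η v) p) := by
  have hd : DifferentiableAt ℝ (shear η v) p := ((contDiff_shear η v).differentiable (by simp)) p
  have hd' : DifferentiableAt ℝ (shear η (-v)) (shear η v p) :=
    ((contDiff_shear η (-v)).differentiable (by simp)) _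
  have hcomp : fderiv ℝ (shear η (-v) ∘ shear η v) p =
      (fderiv ℝ (shear η (-v)) (shear η v p)).comp (fderiv ℝ (shear η v) p) := fderiv_comp p hd' hd
  have hid : shear η (-v) ∘ shear η v = id := funext (shear_neg_shear η v)
  rw [hid, fderiv_id] at hcomp
  refine LeftInverse.injective (g := fderiv ℝ (shear η (-v)) (shear η v p)) fun w ↦ ?_
  have := congrArg (fun L : 𝔼 3 × ℝ →L[ℝ] 𝔼 3 × ℝ ↦ L w) hcomp
  simpa using this.symm

end ArcShear

/-! ### The sheared long annulus -/

namespace LongAnnulus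

open ArcShear

variable {η : ℝ} (A : LongAnnulus η)

/-- **The sheared long annulus** `shear ∘ F`, a long annulus of width `η/4` with the same end
curves and the same levels. [folklore] -/
def shearWith (v : 𝔼 3 × 𝔼 3) : LongAnnulus (η / 4) where
  F := shear η v ∘ A.F
  k₁ := A.k₁
  k₂ := A.k₂
  contDiff_F := (contDiff_shear η v).comp A.contDiff_F
  η_pos := by linarith [A.η_pos]
  η_le := by linarith [A.η_le, A.η_pos]
  F_add_one θ s := by simp only [comp_apply, A.F_add_one]
  collar₁ θ s hs := by
    simp only [comp_apply]
    rw [A.collar₁ θ s (by linarith [A.η_pos])]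
    exact shear_of_le v hs
  collar₂ θ s hs := by
    simp only [comp_apply]
    rw [A.collar₂ θ s (by linarith [A.η_pos])]
    exact shear_of_ge v hs
  margin η' hη' θ s hs := by
    simp only [comp_apply, shear_snd]
    exact A.margin η' ⟨hη'.1, hη'.2.trans (by linarith [A.η_pos])⟩ θ s hs
  margin_Ioo η' hη' θ s hs := by
    simp only [comp_apply, shear_snd]
    exact A.margin_Ioo η' ⟨hη'.1, hη'.2.trans (by linarith [A.η_pos])⟩ θ s hs
  inj p q hp hq he := A.inj p q hp hq (shear_injective η v he)
  injective_fderiv p hp := by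
    have hd : DifferentiableAt ℝ A.F p := (A.contDiff_F.differentiable (by simp)) p
    have hd' : DifferentiableAt ℝ (shear η v) (A.F p) := ((contDiff_shear η v).differentiable (by simp)) _
    rw [fderiv_comp p hd' hd]
    exact (injective_fderiv_shear η v _).comp (A.injective_fderiv p hp)

/-- The sheared annulus as a map. [folklore] -/
@[simp] theorem shearWith_F (v : 𝔼 3 × 𝔼 3) : (A.shearWith v).F = shear η v ∘ A.F := rfl

/-- The sheared annulus has the same lower end curve. [folklore] -/
@[simp] theorem shearWith_k₁ (v : 𝔼 3 × 𝔼 3) : (A.shearWith v).k₁ = A.k₁ := rfl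

/-- The sheared annulus has the same upper end curve. [folklore] -/
@[simp] theorem shearWith_k₂ (v : 𝔼 3 × 𝔼 3) : (A.shearWith v).k₂ = A.k₂ := rfl

/-- The sheared annulus has the same levels. [folklore] -/
theorem snd_shearWith_F (v : 𝔼 3 × 𝔼 3) (p : ℝ × ℝ) : ((A.shearWith v).F p).2 = (A.F p).2 := rfl

/-- The positions of the sheared annulus. [folklore] -/
theorem fst_shearWith_F (v : 𝔼 3 × 𝔼 3) (p : ℝ × ℝ) :
    ((A.shearWith v).F p).1 = (A.F p).1 + β₁ η (A.F p).2 • v.1 + β₂ η (A.F p).2 • v.2 := rfl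

/-! ### The spanning arc and its sheared spatial projection -/

/-- The level along the spanning arc `θ = θ₁`. [folklore] -/
def lev (θ₁ τ : ℝ) : ℝ := (A.F (θ₁, τ)).2

/-- The position along the spanning arc `θ = θ₁`. [folklore] -/
def pos (θ₁ τ : ℝ) : 𝔼 3 := (A.F (θ₁, τ)).1

/-- The spatial projection of the sheared spanning arc. [folklore] -/
def spos (v : 𝔼 3 × 𝔼 3) (θ₁ τ : ℝ) : 𝔼 3 :=
  A.pos θ₁ τ + β₁ η (A.lev θ₁ τ) • v.1 + β₂ η (A.lev θ₁ τ) • v.2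

/-- The spatial projection of the sheared arc is the position of the sheared annulus. [folklore] -/
theorem spos_eq (v : 𝔼 3 × 𝔼 3) (θ₁ τ : ℝ) : A.spos v θ₁ τ = ((A.shearWith v).F (θ₁, τ)).1 := rfl

/-- The arc `τ ↦ F (θ₁, τ)` is `C^∞`. [folklore] -/
theorem contDiff_arc (θ₁ : ℝ) : ContDiff ℝ ∞ fun τ ↦ A.F (θ₁, τ) :=
  A.contDiff_F.comp (contDiff_const.prodMk contDiff_id)

/-- The level along the arc is `C^∞`. [folklore] -/
theorem contDiff_lev (θ₁ : ℝ) : ContDiff ℝ ∞ (A.lev θ₁) := contDiff_snd.comp (A.contDiff_arc θ₁)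

/-- The position along the arc is `C^∞`. [folklore] -/
theorem contDiff_pos (θ₁ : ℝ) : ContDiff ℝ ∞ (A.pos θ₁) := contDiff_fst.comp (A.contDiff_arc θ₁)

/-- The sheared position along the arc is `C^∞`. [folklore] -/
theorem contDiff_spos (v : 𝔼 3 × 𝔼 3) (θ₁ : ℝ) : ContDiff ℝ ∞ (A.spos v θ₁) :=
  ((A.contDiff_pos θ₁).add (((contDiff_β₁ η).comp (A.contDiff_lev θ₁)).smul contDiff_const)).add
    (((contDiff_β₂ η).comp (A.contDiff_lev θ₁)).smul contDiff_const)

/-- The velocity of the arc is the differential of `F` on the vertical vector. [folklore] -/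
theorem hasDerivAt_arc (θ₁ τ : ℝ) :
    HasDerivAt (fun τ ↦ A.F (θ₁, τ)) (fderiv ℝ A.F (θ₁, τ) ((0, 1) : ℝ × ℝ)) τ := by
  have hc : HasDerivAt (fun τ : ℝ ↦ ((θ₁, τ) : ℝ × ℝ)) ((0, 1) : ℝ × ℝ) τ :=
    (hasDerivAt_const τ θ₁).prodMk (hasDerivAt_id τ)
  exact ((A.contDiff_F.differentiable (by simp)) (θ₁, τ)).hasFDerivAt.comp_hasDerivAt τ hc

/-- The velocity of the level along the arc. [folklore] -/
theorem hasDerivAt_lev (θ₁ τ : ℝ) :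
    HasDerivAt (A.lev θ₁) (fderiv ℝ A.F (θ₁, τ) ((0, 1) : ℝ × ℝ)).2 τ :=
  (ContinuousLinearMap.snd ℝ (𝔼 3) ℝ).hasFDerivAt.comp_hasDerivAt τ (A.hasDerivAt_arc θ₁ τ)

/-- The velocity of the position along the arc. [folklore] -/
theorem hasDerivAt_pos (θ₁ τ : ℝ) :
    HasDerivAt (A.pos θ₁) (fderiv ℝ A.F (θ₁, τ) ((0, 1) : ℝ × ℝ)).1 τ :=
  (ContinuousLinearMap.fst ℝ (𝔼 3) ℝ).hasFDerivAt.comp_hasDerivAt τ (A.hasDerivAt_arc θ₁ τ)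

/-- Over `[1, 2]`, the velocity of the arc `(pos', lev')` does not vanish. [folklore] -/
theorem deriv_pos_ne_zero_or {θ₁ τ : ℝ} (hτ : τ ∈ Icc (1 : ℝ) 2) :
    deriv (A.pos θ₁) τ ≠ 0 ∨ deriv (A.lev θ₁) τ ≠ 0 := by
  by_contra h
  push Not at h
  rw [(A.hasDerivAt_pos θ₁ τ).deriv, (A.hasDerivAt_lev θ₁ τ).deriv] at h
  have h0 : fderiv ℝ A.F (θ₁, τ) ((0, 1) : ℝ × ℝ) = 0 := Prod.ext h.1 h.2
  have := (injective_iff_map_eq_zero _).1 (A.injective_fderiv (θ₁, τ) hτ) _ h0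
  simp at this

/-- The velocity of the sheared position along the arc. [folklore] -/
theorem hasDerivAt_spos (v : 𝔼 3 × 𝔼 3) (θ₁ τ : ℝ) :
    HasDerivAt (A.spos v θ₁) (deriv (A.pos θ₁) τ +
      deriv (fun τ ↦ β₁ η (A.lev θ₁ τ)) τ • v.1 + deriv (fun τ ↦ β₂ η (A.lev θ₁ τ)) τ • v.2) τ := by
  have h0 : HasDerivAt (A.pos θ₁) (deriv (A.pos θ₁) τ) τ :=
    (((A.contDiff_pos θ₁).differentiable (by simp)) τ).hasDerivAt
  have h1 : HasDerivAt (fun τ ↦ β₁ η (A.lev θ₁ τ)) (deriv (fun τ ↦ β₁ η (A.lev θ₁ τ)) τ) τ :=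
    ((((contDiff_β₁ η).comp (A.contDiff_lev θ₁)).differentiable (by simp)) τ).hasDerivAt
  have h2 : HasDerivAt (fun τ ↦ β₂ η (A.lev θ₁ τ)) (deriv (fun τ ↦ β₂ η (A.lev θ₁ τ)) τ) τ :=
    ((((contDiff_β₂ η).comp (A.contDiff_lev θ₁)).differentiable (by simp)) τ).hasDerivAt
  exact (h0.add (h1.smul_const v.1)).add (h2.smul_const v.2)

/-- Chain rule for the composed shear coefficients. [folklore] -/
theorem deriv_β_comp_lev (θ₁ τ : ℝ) :
    deriv (fun τ ↦ β₁ η (A.lev θ₁ τ)) τ = deriv (β₁ η) (A.lev θ₁ τ) * deriv (A.lev θ₁) τ ∧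
      deriv (fun τ ↦ β₂ η (A.lev θ₁ τ)) τ = deriv (β₂ η) (A.lev θ₁ τ) * deriv (A.lev θ₁) τ := by
  have hl : HasDerivAt (A.lev θ₁) (deriv (A.lev θ₁) τ) τ :=
    (((A.contDiff_lev θ₁).differentiable (by simp)) τ).hasDerivAt
  have h1 : HasDerivAt (β₁ η) (deriv (β₁ η) (A.lev θ₁ τ)) (A.lev θ₁ τ) :=
    (((contDiff_β₁ η).differentiable (by simp)) _).hasDerivAt
  have h2 : HasDerivAt (β₂ η) (deriv (β₂ η) (A.lev θ₁ τ)) (A.lev θ₁ τ) :=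
    (((contDiff_β₂ η).differentiable (by simp)) _).hasDerivAt
  exact ⟨(h1.comp τ hl).deriv, (h2.comp τ hl).deriv⟩

/-! ### Generic shears -/

/-- **A level in the open middle zone at scale `η/4` can only belong to a parameter in that
zone.** [folklore] -/
theorem mem_Ioo_of_lev_mem {θ₁ τ : ℝ}
    (h : A.lev θ₁ τ ∈ Ioo (1 + η / 4) (2 - η / 4)) : τ ∈ Ioo (1 + η / 4) (2 - η / 4) := by
  constructor
  · by_contra hle
    push Not at hle
    have : A.lev θ₁ τ = τ := A.snd_F_of_le (by linarith [A.η_pos]) θ₁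
    linarith [h.1]
  · by_contra hge
    push Not at hge
    have : A.lev θ₁ τ = τ := A.snd_F_of_ge (by linarith [A.η_pos]) θ₁
    linarith [h.2]

/-- **Generic double shears.** For every long annulus and every `θ₁`, for all `v = (v₁, v₂)`
off a null set of `ℝ³ × ℝ³` — in particular for some `v` — the spatial projection
`τ ↦ (shear (F (θ₁, τ))).1` of the sheared spanning arc (i) takes equal values at parameters
`τ, τ' ∈ [1, 2]` only if `τ = τ'`, as soon as the level of `τ` is in the open middle
`(1 + η/4, 2 - η/4)`, and (ii) has nonzero velocity at every `τ ∈ [1, 2]` whose level is in the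
open middle. (The exceptional `v` satisfy an affine condition `a • v₁ + b • v₂ = Δ` with
`(a, b) ≠ 0`, parametrised by `ℝ²` resp. `ℝ`, a null set — `addHaar_setOf_exists_smul_add_smul_eq`;
if the coefficients vanish, `β (lev τ) = β (lev τ')` forces equal levels (`beta_inj`) and then
injectivity of `F` forces `τ = τ'`, resp. `β' ≠ 0` forces `lev' τ = 0` and then `pos' τ = 0`,
contradicting the immersivity of `F`.) Whitney (1936), §§5–8; Hirsch (1976), Ch. 3 §2.
[folklore] -/
theorem exists_generic_shear (θ₁ : ℝ) :
    ∃ v : 𝔼 3 × 𝔼 3,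
      (∀ τ ∈ Icc (1 : ℝ) 2, ∀ τ' ∈ Icc (1 : ℝ) 2, A.spos v θ₁ τ = A.spos v θ₁ τ' →
        A.lev θ₁ τ ∈ Ioo (1 + η / 4) (2 - η / 4) → τ = τ') ∧
      (∀ τ ∈ Icc (1 : ℝ) 2, A.lev θ₁ τ ∈ Ioo (1 + η / 4) (2 - η / 4) →
        deriv (A.spos v θ₁) τ ≠ 0) := by
  have hη := A.η_le
  -- (i) the bad set for injectivity
  set a : ℝ × ℝ → ℝ := fun p ↦ β₁ η (A.lev θ₁ p.1) - β₁ η (A.lev θ₁ p.2) with ha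
  set b : ℝ × ℝ → ℝ := fun p ↦ β₂ η (A.lev θ₁ p.1) - β₂ η (A.lev θ₁ p.2) with hb
  set Δ : ℝ × ℝ → 𝔼 3 := fun p ↦ A.pos θ₁ p.2 - A.pos θ₁ p.1 with hΔ
  have had : DifferentiableOn ℝ a univ :=
    ((((contDiff_β₁ η).comp (A.contDiff_lev θ₁)).comp contDiff_fst).sub
      (((contDiff_β₁ η).comp (A.contDiff_lev θ₁)).comp contDiff_snd)).differentiable (by simp)
      |>.differentiableOn
  have hbd : DifferentiableOn ℝ b univ :=
    ((((contDiff_β₂ η).comp (A.contDiff_lev θ₁)).comp contDiff_fst).sub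
      (((contDiff_β₂ η).comp (A.contDiff_lev θ₁)).comp contDiff_snd)).differentiable (by simp)
      |>.differentiableOn
  have hΔd : DifferentiableOn ℝ Δ univ :=
    (((A.contDiff_pos θ₁).comp contDiff_snd).sub ((A.contDiff_pos θ₁).comp contDiff_fst)).differentiable
      (by simp) |>.differentiableOn
  have hdim1 : Module.finrank ℝ (ℝ × ℝ) < Module.finrank ℝ (𝔼 3) := by simp [Module.finrank_prod]
  set μ : Measure (𝔼 3 × 𝔼 3) := (volume : Measure (𝔼 3)).prod volume with hμ
  have hN₁ := addHaar_setOf_exists_smul_add_smul_eq μ hdim1 had hbd hΔd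
  -- (ii) the bad set for immersivity
  set a₂ : ℝ → ℝ := fun τ ↦ deriv (fun τ ↦ β₁ η (A.lev θ₁ τ)) τ with ha₂
  set b₂ : ℝ → ℝ := fun τ ↦ deriv (fun τ ↦ β₂ η (A.lev θ₁ τ)) τ with hb₂
  set Δ₂ : ℝ → 𝔼 3 := fun τ ↦ -deriv (A.pos θ₁) τ with hΔ₂
  have ha₂d : DifferentiableOn ℝ a₂ univ :=
    ((contDiff_infty_iff_deriv.1 ((contDiff_β₁ η).comp (A.contDiff_lev θ₁))).2.differentiable
      (by simp)).differentiableOn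
  have hb₂d : DifferentiableOn ℝ b₂ univ :=
    ((contDiff_infty_iff_deriv.1 ((contDiff_β₂ η).comp (A.contDiff_lev θ₁))).2.differentiable
      (by simp)).differentiableOn
  have hΔ₂d : DifferentiableOn ℝ Δ₂ univ :=
    ((contDiff_infty_iff_deriv.1 (A.contDiff_pos θ₁)).2.differentiable (by simp)).neg.differentiableOn
  have hdim2 : Module.finrank ℝ ℝ < Module.finrank ℝ (𝔼 3) := by simp
  have hN₂ := addHaar_setOf_exists_smul_add_smul_eq μ hdim2 ha₂d hb₂d hΔ₂d
  -- a good parameter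
  obtain ⟨v, -, hv⟩ := exists_mem_notMem_of_measure_zero μ isOpen_univ
    univ_nonempty (measure_union_null hN₁ hN₂)
  rw [mem_union, not_or] at hv
  obtain ⟨hv₁, hv₂⟩ := hv
  refine ⟨v, fun τ hτ τ' hτ' he hlev ↦ ?_, fun τ hτ hlev hder ↦ ?_⟩
  · -- (i)
    have heq : a (τ, τ') • v.1 + b (τ, τ') • v.2 = Δ (τ, τ') := by
      simp only [ha, hb, hΔ, spos] at he ⊢
      rw [sub_smul, sub_smul]
      linear_combination (norm := module) he
    have hab : a (τ, τ') = 0 ∧ b (τ, τ') = 0 := by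
      by_contra hne
      exact hv₁ ⟨(τ, τ'), mem_univ _, not_and_or.1 hne, heq⟩
    have h1 : β₁ η (A.lev θ₁ τ) = β₁ η (A.lev θ₁ τ') := sub_eq_zero.1 hab.1
    have h2 : β₂ η (A.lev θ₁ τ) = β₂ η (A.lev θ₁ τ') := sub_eq_zero.1 hab.2
    have hll : A.lev θ₁ τ = A.lev θ₁ τ' := beta_inj hη h1 h2 hlev
    have hΔ0 : Δ (τ, τ') = 0 := by rw [← heq, hab.1, hab.2, zero_smul, zero_smul, add_zero]
    have hpp : A.pos θ₁ τ = A.pos θ₁ τ' := (sub_eq_zero.1 hΔ0).symm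
    have hF : A.F (θ₁, τ) = A.F (θ₁, τ') := Prod.ext hpp hll
    exact (A.inj (θ₁, τ) (θ₁, τ') hτ hτ' hF).1
  · -- (ii)
    rw [(A.hasDerivAt_spos v θ₁ τ).deriv] at hder
    have heq : a₂ τ • v.1 + b₂ τ • v.2 = Δ₂ τ := by
      simp only [ha₂, hb₂, hΔ₂]
      rw [eq_neg_iff_add_eq_zero, ← hder]
      abel
    have hab : a₂ τ = 0 ∧ b₂ τ = 0 := by
      by_contra hne
      exact hv₂ ⟨τ, mem_univ _, not_and_or.1 hne, heq⟩
    obtain ⟨e1, e2⟩ := A.deriv_β_comp_lev θ₁ τ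
    have hl0 : deriv (A.lev θ₁) τ = 0 := by
      by_contra hl
      have h1 : deriv (β₁ η) (A.lev θ₁ τ) = 0 := by
        have := hab.1; rw [ha₂] at this; simp only at this; rw [e1] at this
        exact (mul_eq_zero.1 this).resolve_right hl
      have h2 : deriv (β₂ η) (A.lev θ₁ τ) = 0 := by
        have := hab.2; rw [hb₂] at this; simp only at this; rw [e2] at this
        exact (mul_eq_zero.1 this).resolve_right hl
      exact not_deriv_beta_eq_zero hη hlev ⟨h1, h2⟩
    have hp0 : deriv (A.pos θ₁) τ = 0 := by
      have := hder
      rw [show deriv (fun τ ↦ β₁ η (A.lev θ₁ τ)) τ = a₂ τ from rfl,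
        show deriv (fun τ ↦ β₂ η (A.lev θ₁ τ)) τ = b₂ τ from rfl, hab.1, hab.2, zero_smul,
        zero_smul, add_zero, add_zero] at this
      exact this
    rcases A.deriv_pos_ne_zero_or (θ₁ := θ₁) hτ with h | h
    · exact h hp0
    · exact h hl0

end LongAnnulus

end Literature.Topology.FourManifolds
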